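import Literature.AlgebraicGeometry.Motives.IntegralModelOfFiniteQuotient
import Literature.AlgebraicGeometry.Motives.IntegralModelReductionMap
import Literature.AlgebraicGeometry.RelativeSpec.GeometricQuotientTameSmoothCurve
import Mathlib.AlgebraicGeometry.ResidueField
import HarnessLib

/-!
# The tame quotient of a smooth proper relative curve over `𝒪_{K,(v)}` is a smooth proper model of the quotient
# (SGA 1 V 1.5 ∕ 1.9; Katz–Mazur A7.1), packaged for integral models

Topic `AlgebraicGeometry/Motives` (integral models); namespace `Literature.AlgebraicGeometry.Motives`.  PROOF file: theorems
only — no definition, no named fact, no instance, no notation.  Cell `pub/hodgecm-mathlib`, programme P6 («MOD»), hand M-Q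
(«tame level quotient», LEAD F0P6-plan ruling M-1 (F) ∕ M-1a (4)): the INTEGRAL HALF of the letter
`F0D9opRoad2.RecordTameLevelQuotientModel`, stated generically.

## Mathematics

Let `K` be a number field, `v` a finite place, `𝒪 = 𝒪_{K,(v)}` (`valuationSubringAtPrime K v`, a discrete valuation ring
with fraction field `K` and finite residue field), `𝒳₁ → Spec 𝒪` an integral model of a `K`-scheme `X₁` which is SMOOTH OF
RELATIVE DIMENSION `1` AND PROPER, and `G` a finite group of order invertible in `𝒪` acting on `𝒳₁` over `Spec 𝒪` with every
point in a `G`-stable affine open.  If the induced action `σ` on the generic fibre `X₁` has a geometric quotient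
`q : X₁ → X` over `K` (with `X` separated), then `𝒳 := 𝒳₁/G` IS a smooth proper integral model of `X` of relative dimension
`1`, and the quotient map `ū : 𝒳₁ → 𝒳` is finite surjective with generic fibre `q`:
* the quotient exists and is an integral model of `X` with `ū_K = q` and proper total space — ★
  `IntegralModel.exists_quotient_of_isProper` (SGA 1 V Prop. 1.9, Cor. 1.5; uniqueness of geometric quotients);
* it is smooth of relative dimension `1` — ★ `ActionOver.smoothOfRelativeDimension_one_and_isProper_gluedDesc_of_isUnit_card`
  ([KatzMazur1985, A7.1]: tame quotients of smooth curves over a base with PERFECT residue fields), transported to the packaged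
  model by the transfer clause of the first theorem; the residue fields of `Spec 𝒪_{K,(v)}` are `K` (characteristic `0`) and
  `𝒪_K/v` (finite), both perfect (§1).

## Contents
* §1 `perfectField_residueField_spec_valuationSubringAtPrime` — every residue field of `Spec 𝒪_{K,(v)}` is perfect (two
  private plumbing lemmas: flatness of `K` over `𝒪_{K,(v)}`, units of `Γ(Spec 𝒪, 𝒪)`).
* §2 **`IntegralModel.exists_tameQuotient_isSmoothProper_one`** — the packaged statement above, conclusion in the
  `genericFibre`∕`genericIso'` currency of ★ `IntegralModelReductionMap`.

## References
* [SGA1] A. Grothendieck, *SGA 1*, Exp. V §1, Prop. 1.8, Prop. 1.9, Cor. 1.5.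
* [KatzMazur1985] N. M. Katz, B. Mazur, *Arithmetic Moduli of Elliptic Curves*, A7.1 (tame quotients of smooth curves).
* [SerreTate1968] J.-P. Serre, J. Tate, *Good reduction of abelian varieties*, §1 (models).
-/

set_option autoImplicit false

noncomputable section

open CategoryTheory CategoryTheory.Limits AlgebraicGeometry IsDedekindDomain IsDedekindDomain.HeightOneSpectrum
open scoped NumberField

namespace Literature.AlgebraicGeometry.Motives

open Literature.AlgebraicGeometry.RelativeSpec
open Literature.NumberTheory.EllipticCurves (genericFibre specGenericPoint)

/-! ## §1 The base `Spec 𝒪_{K,(v)}`: perfect residue fields, flat fraction field -/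

section Base

variable {K : Type} [Field K] [NumberField K] (v : HeightOneSpectrum (𝓞 K))

/-- **Every residue field of `Spec 𝒪_{K,(v)}` is perfect**: the generic point has residue field of characteristic `0` (the
kernel of `𝒪 → κ(η)` is `(0)`), the closed point has the FINITE residue field `𝒪_K/v` (a non-zero prime of the discrete
valuation ring `𝒪_{K,(v)}` is its maximal ideal; ★ `residueFieldEquiv`); transport to Mathlib's `Scheme.residueField` along
`Scheme.Spec.residueFieldIso`.  This is the hypothesis `hperf` of ★ `ActionOver.smoothOfRelativeDimension_one_gluedDesc_of_isUnit_card`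
for the base `Spec 𝒪_{K,(v)}`. [cite: KatzMazur1985, A7.1] -/
theorem perfectField_residueField_spec_valuationSubringAtPrime
    (y : Spec (CommRingCat.of (valuationSubringAtPrime K v))) :
    PerfectField ((Spec (CommRingCat.of (valuationSubringAtPrime K v))).residueField y) := by
  haveI : PerfectField y.asIdeal.ResidueField := by
    by_cases h : y.asIdeal = ⊥
    · -- generic point: characteristic zero
      haveI : CharZero y.asIdeal.ResidueField :=
        charZero_of_injective_algebraMap (R := valuationSubringAtPrime K v) (by
          rw [RingHom.injective_iff_ker_eq_bot, Ideal.ker_algebraMap_residueField, h])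
      infer_instance
    · -- closed point: finite residue field
      haveI : IsDiscreteValuationRing (valuationSubringAtPrime K v) :=
        IsLocalization.AtPrime.isDiscreteValuationRing_of_dedekind_domain (𝓞 K) v.ne_bot _
      have hmax : y.asIdeal = IsLocalRing.maximalIdeal (valuationSubringAtPrime K v) :=
        IsLocalRing.eq_maximalIdeal (Ideal.IsPrime.isMaximal inferInstance h)
      haveI : Finite (valuationSubringAtPrime K v ⧸ y.asIdeal) := by
        rw [hmax]
        exact Finite.of_equiv _ (residueFieldEquiv v).symm.toEquiv
      infer_instance
  exact PerfectField.of_ringEquiv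
    (Scheme.Spec.residueFieldIso (CommRingCat.of (valuationSubringAtPrime K v)) y).commRingCatIsoToRingEquiv.symm

/-- `K` is flat over `𝒪_{K,(v)}` (a localisation: `K = Frac 𝒪_{K,(v)}`; private plumbing). [folklore] -/
private theorem flat_valuationSubringAtPrime : Module.Flat (valuationSubringAtPrime K v) K :=
  IsLocalization.flat K (nonZeroDivisors (valuationSubringAtPrime K v))

/-- An integer invertible in `𝒪_{K,(v)}` is invertible in the ring of global sections `Γ(Spec 𝒪_{K,(v)}, 𝒪)` (private
plumbing). [folklore] -/
private theorem isUnit_natCast_sections_of_isUnit (n : ℕ) (hn : IsUnit ((n : ℕ) : valuationSubringAtPrime K v)) :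
    IsUnit ((n : ℕ) : Γ(Spec (CommRingCat.of (valuationSubringAtPrime K v)), ⊤)) := by
  have h := hn.map (Scheme.ΓSpecIso (CommRingCat.of (valuationSubringAtPrime K v))).inv.hom
  rwa [map_natCast] at h

end Base

/-! ## §2 The tame quotient of a smooth proper model of relative dimension `1` -/

section TameQuotient

variable {K : Type} [Field K] [NumberField K] {v : HeightOneSpectrum (𝓞 K)}
  {G : Type} [Group G] [Finite G] {X₁ X : SchemeOver K}

set_option backward.isDefEq.respectTransparency false

/-- **The tame quotient of a smooth proper model of relative dimension `1` over `𝒪_{K,(v)}` is a smooth proper model of the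
quotient.**  Let `𝒳₁` be an integral model over `𝒪_{K,(v)}` of the `K`-scheme `X₁`, smooth of relative dimension `1` and
proper, with an action `ρ` of a finite group `G` over `Spec 𝒪_{K,(v)}` such that every point lies in a `G`-stable affine open
and `|G|` is invertible in `𝒪_{K,(v)}` (TAMENESS); let `σ` be an action of `G` on `X₁` over `K` compatible with `ρ` through
`𝒳₁.genericIso`, and `q : X₁ → X` a geometric quotient by `σ` over `K`, `X` separated over `K`.  Then there is an integral
model `𝒳` of `X`, SMOOTH OF RELATIVE DIMENSION `1` AND PROPER (`𝒳.IsSmoothProper 1`), with a FINITE SURJECTIVE model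
morphism `ū : 𝒳₁ → 𝒳` whose generic fibre is `q`: `ū_K ≫ 𝒳.genericIso' = 𝒳₁.genericIso' ≫ q`.  (★
`IntegralModel.exists_quotient_of_isProper` for the model, properness, finiteness and the generic fibre — SGA 1 V 1.9 ∕ 1.5;
★ `ActionOver.smoothOfRelativeDimension_one_and_isProper_gluedDesc_of_isUnit_card` for smoothness — Katz–Mazur A7.1 — over
the base `Spec 𝒪_{K,(v)}` whose residue fields are perfect (§1), ported to `𝒳` by the transfer clause.)
[cite: KatzMazur1985, A7.1] -/
theorem IntegralModel.exists_tameQuotient_isSmoothProper_one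
    (𝒳₁ : IntegralModel (valuationSubringAtPrime K v) K X₁) (h𝒳₁ : 𝒳₁.IsSmoothProper 1)
    (ρ : ActionOver 𝒳₁.total.hom G) (hcov : ∀ x : ↥𝒳₁.total.left, ∃ O : ρ.StableAffineOpens, x ∈ O.1)
    (hcard : IsUnit ((Nat.card G : ℕ) : valuationSubringAtPrime K v))
    [IsSeparated X.hom] (σ : ActionOver X₁.hom G)
    (hσ : ∀ g : G, (σ.aut g).hom ≫ 𝒳₁.genericIso.inv.left ≫
        pullback.fst 𝒳₁.total.hom (Spec.map (CommRingCat.ofHom (algebraMap (valuationSubringAtPrime K v) K))) =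
      (𝒳₁.genericIso.inv.left ≫
        pullback.fst 𝒳₁.total.hom (Spec.map (CommRingCat.ofHom (algebraMap (valuationSubringAtPrime K v) K)))) ≫
          (ρ.aut g).hom)
    (q : X₁ ⟶ X) (hq : σ.IsGeometricQuotient q.left) :
    ∃ (𝒳 : IntegralModel (valuationSubringAtPrime K v) K X) (_ : 𝒳.IsSmoothProper 1) (ū : 𝒳₁.total ⟶ 𝒳.total),
      IsFinite ū.left ∧ Surjective ū.left ∧
        (genericFibre (valuationSubringAtPrime K v) K).map ū ≫ 𝒳.genericIso'.hom = 𝒳₁.genericIso'.hom ≫ q := by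
  haveI : Module.Flat (valuationSubringAtPrime K v) K := flat_valuationSubringAtPrime v
  haveI : IsProper 𝒳₁.total.hom := h𝒳₁.2
  haveI : SmoothOfRelativeDimension 1 𝒳₁.total.hom := h𝒳₁.1
  obtain ⟨𝒳, ū, h₁, -, hP, hfin, hsurj, h₃, -, -, -⟩ :=
    𝒳₁.exists_quotient_of_isProper ρ hcov σ hσ q.left (Over.w q) hq
  -- smoothness of the quotient (tame action on a smooth proper relative curve over a base with perfect residue fields)
  have hsm : SmoothOfRelativeDimension 1 (ρ.gluedDesc 𝒳₁.total.hom ρ.aut_comp) :=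
    (ρ.smoothOfRelativeDimension_one_and_isProper_gluedDesc_of_isUnit_card hcov h𝒳₁.2
      (isUnit_natCast_sections_of_isUnit v (Nat.card G) hcard)
      (perfectField_residueField_spec_valuationSubringAtPrime v)).1
  refine ⟨𝒳, ⟨h₁ _ hsm, hP⟩, ū, hfin, hsurj, ?_⟩
  -- the generic square, from clause (iii) `genericIso₁⁻¹ ≫ ū_K ≫ genericIso = q`
  have hid : 𝒳₁.genericIso.hom.left ≫ 𝒳₁.genericIso.inv.left = 𝟙 _ := by
    rw [← Over.comp_left, Iso.hom_inv_id, Over.id_left]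
  ext : 1
  rw [Over.comp_left, Over.comp_left]
  change ((baseChange (valuationSubringAtPrime K v) K).map ū).left ≫ 𝒳.genericIso.hom.left =
    𝒳₁.genericIso.hom.left ≫ q.left
  rw [← h₃, reassoc_of% hid]

end TameQuotient

end Literature.AlgebraicGeometry.Motives

end
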